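import Literature.Probability.LatticeModels.TemperleyLiebDyckWord
import HarnessLib

/-!
# A link pattern is determined by its depth profile (Dyck-path injectivity, completed)

Topic `Literature/Probability/LatticeModels`; a rider on `TemperleyLiebDyckWord.lean` (`PerfectMatching.IsOpener`, ★★★ `LinkPattern.eq_of_isOpener_iff`: the set of opening
sites determines a link pattern). This file supplies the arithmetic half — THE DEPTH PROFILE DETERMINES THE OPENING SITES — valid for EVERY pairing (planarity not needed),
and concludes (T3) of the door-(U) «skyline» strategy (HOME `FINDING-TRIPOD-DOOR-U-TWO-CORNER.md` §4) for link patterns: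

* `PerfectMatching.pmDepth p j` — the number of chords strictly over `j` (`#{a : a < j < p a}`; the tree's `depth` of `MarkedLoopTripodRank` in pairing language);
  `openBefore p j` — the number of chords opened before `j` and not yet closed AT `j` (`#{a < j : j ≤ p a}`, i.e. including the chord closing at `j`);
* `pmDepth_eq_openBefore_sub` — `pmDepth p j + [j closes] = openBefore p j` for every pairing; `openBefore_eq_card_sub` — `openBefore p j + #{closers < j} = #{openers < j}`
  (the closers before `j` are in bijection with the openers before `j` that closed before `j`);
* ★★ `PerfectMatching.isOpener_iff_of_depth_eq` — two pairings with the same depth profile have the same opening sites (induction on the site);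
* ★★★ `LinkPattern.eq_of_pmDepth_eq` — **TWO LINK PATTERNS WITH THE SAME DEPTH PROFILE ARE EQUAL.**

## References
* P. A. Pearce, V. Rittenberg, J. de Gier, B. Nienhuis, J. Phys. A 35 (2002) L661–L668, §2 (link patterns ↔ Catalan / Dyck structures).
* R. P. Grimaldi, *Fibonacci and Catalan Numbers* (2012), Ch. 32, Example 32.3.

## Mathlib / tree
Tree: `TemperleyLiebDyckWord.lean` (`IsOpener`, `partner_lt_of_not_isOpener`, `isOpener_partner_iff`, `LinkPattern.eq_of_isOpener_iff`), `TemperleyLiebLinkPatterns.lean`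
(`PerfectMatching`, `partner_partner`, `partner_inj`). Mathlib: `Finset.card_nbij`, `Finset.filter_filter`, `Finset.card_union_of_disjoint`, `Fin.induction`-free strong
induction via `Nat.strong_induction_on` on `j.val`.
-/

namespace Literature.Probability.LatticeModels.TemperleyLieb

open Finset

variable {L : ℕ}

namespace PerfectMatching

variable (p : PerfectMatching L)

/-- **the depth of a site**: the number of chords passing strictly over it. [cite: PearceRittenbergDeGierNienhuis2002, §2 (half-loops)] -/
def pmDepth (j : Fin L) : ℕ := (Finset.univ.filter fun a : Fin L => a < j ∧ j < p.partner a).card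

/-- the number of chords opened before `j` and still open at `j` (the chord closing at `j`, if any, included). [cite: PearceRittenbergDeGierNienhuis2002, §2] -/
def openBefore (j : Fin L) : ℕ := (Finset.univ.filter fun a : Fin L => a < j ∧ j ≤ p.partner a).card

open Classical in
/-- ★ `pmDepth + [j closes] = openBefore` — for every pairing. [cite: PearceRittenbergDeGierNienhuis2002, §2] -/
theorem pmDepth_add_eq_openBefore (j : Fin L) : p.pmDepth j + (if p.IsOpener j then 0 else 1) = p.openBefore j := by
  classical
  unfold pmDepth openBefore
  have hsplit : (Finset.univ.filter fun a : Fin L => a < j ∧ j ≤ p.partner a) =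
      (Finset.univ.filter fun a : Fin L => a < j ∧ j < p.partner a) ∪ (Finset.univ.filter fun a : Fin L => a < j ∧ p.partner a = j) := by
    ext a
    simp only [Finset.mem_filter, Finset.mem_univ, true_and, Finset.mem_union]
    constructor
    · rintro ⟨h1, h2⟩
      rcases lt_or_eq_of_le h2 with h2 | h2
      · exact Or.inl ⟨h1, h2⟩
      · exact Or.inr ⟨h1, h2.symm⟩
    · rintro (⟨h1, h2⟩ | ⟨h1, h2⟩)
      · exact ⟨h1, h2.le⟩
      · exact ⟨h1, h2.ge⟩
  have hdisj : Disjoint (Finset.univ.filter fun a : Fin L => a < j ∧ j < p.partner a) (Finset.univ.filter fun a : Fin L => a < j ∧ p.partner a = j) := by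
    rw [Finset.disjoint_filter]
    intro a _ h1 h2
    exact (ne_of_gt h1.2) h2.2
  rw [hsplit, Finset.card_union_of_disjoint hdisj]
  congr 1
  split_ifs with hup
  · -- `j` opens: no chord closes at `j` from the left
    symm
    rw [Finset.card_eq_zero, Finset.filter_eq_empty_iff]
    intro a _ h
    have : p.partner j = a := by rw [← h.2, p.partner_partner]
    exact lt_asymm h.1 (by have hj := hup; unfold IsOpener at hj; rw [this] at hj; exact hj)
  · -- `j` closes: exactly the chord from `p j`
    symm
    rw [Finset.card_eq_one]
    refine ⟨p.partner j, ?_⟩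
    ext a
    simp only [Finset.mem_filter, Finset.mem_univ, true_and, Finset.mem_singleton]
    constructor
    · rintro ⟨-, h2⟩
      rw [← h2, p.partner_partner]
    · rintro rfl
      exact ⟨p.partner_lt_of_not_isOpener hup, p.partner_partner j⟩

open Classical in
/-- ★ `openBefore + #{closers before j} = #{openers before j}`: the closers before `j` are matched bijectively (by `partner`) with the openers before `j` that are no longer open
at `j`. [cite: PearceRittenbergDeGierNienhuis2002, §2] -/
theorem openBefore_add_card_closers (j : Fin L) :
    p.openBefore j + (Finset.univ.filter fun c : Fin L => c < j ∧ ¬ p.IsOpener c).card = (Finset.univ.filter fun a : Fin L => a < j ∧ p.IsOpener a).card := by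
  classical
  unfold openBefore
  -- split the openers before `j` by whether their chord is still open at `j`
  have hsplit : (Finset.univ.filter fun a : Fin L => a < j ∧ p.IsOpener a) =
      (Finset.univ.filter fun a : Fin L => a < j ∧ j ≤ p.partner a) ∪ (Finset.univ.filter fun a : Fin L => a < j ∧ p.IsOpener a ∧ p.partner a < j) := by
    ext a
    simp only [Finset.mem_filter, Finset.mem_univ, true_and, Finset.mem_union]
    constructor
    · rintro ⟨h1, h2⟩
      rcases le_or_gt j (p.partner a) with h3 | h3
      · exact Or.inl ⟨h1, h3⟩
      · exact Or.inr ⟨h1, h2, h3⟩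
    · rintro (⟨h1, h2⟩ | ⟨h1, h2, -⟩)
      · exact ⟨h1, lt_of_lt_of_le h1 h2⟩
      · exact ⟨h1, h2⟩
  have hdisj : Disjoint (Finset.univ.filter fun a : Fin L => a < j ∧ j ≤ p.partner a) (Finset.univ.filter fun a : Fin L => a < j ∧ p.IsOpener a ∧ p.partner a < j) := by
    rw [Finset.disjoint_filter]
    intro a _ h1 h2
    exact not_lt.2 h1.2 h2.2.2
  rw [hsplit, Finset.card_union_of_disjoint hdisj]
  congr 1
  -- closers before `j` ↔ openers before `j` closed before `j`, via `partner`
  apply Finset.card_nbij (fun c => p.partner c)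
  · intro c hc
    rw [Finset.mem_coe, Finset.mem_filter] at hc
    obtain ⟨-, h1, h2⟩ := hc
    rw [Finset.mem_coe, Finset.mem_filter]
    refine ⟨Finset.mem_univ _, (p.partner_lt_of_not_isOpener h2).trans h1, (p.isOpener_partner_iff c).2 h2, ?_⟩
    rw [p.partner_partner]; exact h1
  · intro c _ c' _ h
    exact p.partner_inj.1 h
  · intro a ha
    rw [Finset.mem_coe, Finset.mem_filter] at ha
    obtain ⟨-, h1, h2, h3⟩ := ha
    refine ⟨p.partner a, ?_, p.partner_partner a⟩
    rw [Finset.mem_coe, Finset.mem_filter]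
    exact ⟨Finset.mem_univ _, h3, fun h4 => ((p.isOpener_partner_iff a).1 h4) h2⟩

open Classical in
/-- ★★ **TWO PAIRINGS WITH THE SAME DEPTH PROFILE HAVE THE SAME OPENING SITES** (every pairing; induction on the site: the openers and closers before `j` agree, hence
`openBefore` agrees, and `pmDepth j = openBefore j` exactly when `j` opens). [cite: PearceRittenbergDeGierNienhuis2002, §2 (Dyck / ballot structure)] -/
theorem isOpener_iff_of_pmDepth_eq (p q : PerfectMatching L) (h : ∀ j : Fin L, p.pmDepth j = q.pmDepth j) (j : Fin L) : p.IsOpener j ↔ q.IsOpener j := by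
  classical
  -- strong induction on `j.val`
  suffices H : ∀ n : ℕ, ∀ j : Fin L, j.val = n → (p.IsOpener j ↔ q.IsOpener j) from H j.val j rfl
  intro n
  induction n using Nat.strong_induction_on with
  | _ n ih =>
    intro j hj
    -- openers / closers before `j` agree
    have hO : (Finset.univ.filter fun a : Fin L => a < j ∧ p.IsOpener a) = (Finset.univ.filter fun a : Fin L => a < j ∧ q.IsOpener a) := by
      ext a
      simp only [Finset.mem_filter, Finset.mem_univ, true_and]
      constructor
      · rintro ⟨h1, h2⟩; exact ⟨h1, (ih a.val (by rw [← hj]; exact h1) a rfl).1 h2⟩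
      · rintro ⟨h1, h2⟩; exact ⟨h1, (ih a.val (by rw [← hj]; exact h1) a rfl).2 h2⟩
    have hC : (Finset.univ.filter fun c : Fin L => c < j ∧ ¬ p.IsOpener c) = (Finset.univ.filter fun c : Fin L => c < j ∧ ¬ q.IsOpener c) := by
      ext a
      simp only [Finset.mem_filter, Finset.mem_univ, true_and]
      constructor
      · rintro ⟨h1, h2⟩; exact ⟨h1, fun h3 => h2 ((ih a.val (by rw [← hj]; exact h1) a rfl).2 h3)⟩
      · rintro ⟨h1, h2⟩; exact ⟨h1, fun h3 => h2 ((ih a.val (by rw [← hj]; exact h1) a rfl).1 h3)⟩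
    have hOB : p.openBefore j = q.openBefore j := by
      have hp := p.openBefore_add_card_closers j
      have hq := q.openBefore_add_card_closers j
      rw [hO, hC] at hp
      omega
    have hp := p.pmDepth_add_eq_openBefore j
    have hq := q.pmDepth_add_eq_openBefore j
    rw [h j, hOB] at hp
    by_cases hpj : p.IsOpener j <;> by_cases hqj : q.IsOpener j
    · exact ⟨fun _ => hqj, fun _ => hpj⟩
    · rw [if_pos hpj] at hp; rw [if_neg hqj] at hq; omega
    · rw [if_neg hpj] at hp; rw [if_pos hqj] at hq; omega
    · exact ⟨fun h' => absurd h' hpj, fun h' => absurd h' hqj⟩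

end PerfectMatching

/-- ★★★ **A LINK PATTERN IS DETERMINED BY ITS DEPTH PROFILE**: two non-crossing pairings of `Fin L` with `pmDepth P j = pmDepth Q j` for all `j` are equal — the
injectivity of «link pattern ↦ Dyck path» ((T3) of the lane's skyline strategy for door (U)). [cite: PearceRittenbergDeGierNienhuis2002, §2 (link patterns, `C_{L,m}`); Grimaldi2012, Ex. 32.3] -/
theorem LinkPattern.eq_of_pmDepth_eq (P Q : LinkPattern L) (h : ∀ j : Fin L, P.1.pmDepth j = Q.1.pmDepth j) : P = Q :=
  LinkPattern.eq_of_isOpener_iff P Q (PerfectMatching.isOpener_iff_of_pmDepth_eq P.1 Q.1 h)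

end Literature.Probability.LatticeModels.TemperleyLieb
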